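import Literature.Analysis.Complex.HarnackPrinciple
import Literature.Analysis.Complex.HarmonicMaxPrinciple
import HarnessLib

/-!
# A Schwarz lemma for harmonic functions on an annulus

Topic `Literature/Analysis/Complex` (PROOF-ONLY: no definition, no named fact; classical potential theory in
the plane, [folklore]).  The estimate of this file is the planar heart of Step 1 of the proof of I-Hsiung
Lin, *Classical Complex Analysis: A Geometric Approach*, vol. 2 (World Scientific 2011), §7.3.3, (7.3.3.3)
«Existence of a harmonic function with a singularity on a nonhyperbolic Riemann surface» (held copy, chunks
p0436–p0437, displays (*5)–(*12); Lin follows H. M. Farkas, I. Kra, *Riemann Surfaces*, IV.3, pp. 172–178),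
done there by Fourier series on the annulus and Schwarz reflection across the inner circle; here it is
obtained WITHOUT series from Harnack's inequality and the maximum principle:

**Theorem (`abs_le_mul_norm_of_harmonicOnNhd_annulus`).** Let `w` be continuous on the closed annulus
`ρ ≤ ‖z − c‖ ≤ R` (`0 < ρ < R`) and harmonic inside, with `w = 0` on the inner circle, `|w| ≤ K` on the
outer circle and `⨍_{‖z−c‖=R} w = 0`.  Then `|w(z)| ≤ 4K‖z − c‖/R` on the closed annulus.

Proof.  Let `h := P[w|_{‖z−c‖=R}]` be the Poisson integral (the tree's `discPoisson`); `h(c) = ⨍ w = 0`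
and `|h| ≤ K`, so the HARMONIC SCHWARZ LEMMA (`abs_le_of_harmonicOnNhd_ball_of_apply_center`: Harnack's
inequality `TuranNazarov.harnack` applied to `K ± h` on the discs `‖z − c‖ ≤ R′ < R`) gives
`|h(z)| ≤ 2K‖z − c‖/R`; and `w − h` is harmonic on the open annulus, continuous on the closed one, `0` on
the outer circle and of size `≤ 2Kρ/R` on the inner one, so `|w − h| ≤ 2Kρ/R ≤ 2K‖z − c‖/R` by the
two-sided MAXIMUM PRINCIPLE ON THE ANNULUS (`abs_le_of_harmonicOnNhd_annulus`, from the tree's lim-sup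
principle `harmonic_le_of_frontier_of_cocompact` on the bounded preconnected open annulus).  The zero-mean
hypothesis cannot be dropped: `w = K log(‖z−c‖/ρ)/log(R/ρ)` satisfies the other three and equals `K/2` on
`‖z − c‖ = √(ρR)`.  On a Riemann surface that hypothesis is ZERO FLUX, Lin's Lemma (7.3.3.4); the sequel
`Literature/Analysis/Complex/HarmonicDipoleEstimate.lean` supplies it from holomorphy and turns this bound
into Lin's uniform estimate (*5) for the dipole datum `Re (z − c)⁻¹` and the removability of Step 3.

## Contents

* §0 (private) `isPreconnected_ball_diff_closedBall`, `frontier_ball_diff_closedBall_subset`,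
  `mem_sphere_or_of_mem_closedBall_diff_ball` — the open / closed annulus;
* §1 `abs_discPoisson_le`, (private) `discPoisson_apply_center` — `|P[φ]| ≤ K` on the closed disc,
  `P[φ](c) = ⨍ φ`;
* §2 `abs_le_of_harmonicOnNhd_ball_of_apply_center` — the harmonic Schwarz lemma;
* §3 `abs_le_of_harmonicOnNhd_annulus` — two-sided maximum principle on a closed annulus;
* §4 `abs_le_mul_norm_of_harmonicOnNhd_annulus` — the annulus Schwarz bound.

Written for the abc-iut cell's programme «UNIF-G1P» Tier 2 (GAP G-L4t8g7-2, brick P6 «parabolic case»);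
classical mathematics, nothing here bears on [IUTchIII] Cor. 3.12.

## References
* [Lin2011ClassicalComplexAnalysisII] I-Hsiung Lin, *Classical Complex Analysis: A Geometric Approach*,
  vol. 2 (2011), §7.3.3 (7.3.3.3), proof, Step 1.
* [FarkasKra1992] H. M. Farkas, I. Kra, *Riemann Surfaces*, 2nd ed. (1992), IV.1.5 (Harnack's inequality),
  IV.3 (pp. 172–178).
-/

noncomputable section

open scoped Topology

namespace Literature.Analysis.Complex

open _root_.Complex Metric Set Filter Real InnerProductSpace

/-! ### §0 The open annulus -/

/-- The open annulus `r < ‖z − c‖ < R` (`0 ≤ r`) is preconnected (polar coordinates) — in the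
set-difference spelling `ball c R \ closedBall c r` of Mathlib's annulus Cauchy theorem (the tree's
`Literature.Geometry.Kaehler.RiemannSurface.isPreconnected_annulus` is the `setOf` spelling). [folklore] -/
private theorem isPreconnected_ball_diff_closedBall (c : ℂ) {r : ℝ} (R : ℝ) (hr : 0 ≤ r) :
    IsPreconnected (ball c R \ closedBall c r) := by
  have heq : ball c R \ closedBall c r =
      (fun q : ℝ × ℝ => c + (q.1 : ℂ) * exp ((q.2 : ℂ) * I)) '' (Ioo r R ×ˢ univ) := by
    ext z
    simp only [Set.mem_sdiff, mem_ball, mem_closedBall, not_le, dist_eq_norm, mem_image, mem_prod, mem_univ,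
      and_true, mem_Ioo, Prod.exists]
    constructor
    · rintro ⟨h1, h2⟩
      refine ⟨‖z - c‖, arg (z - c), ⟨h2, h1⟩, ?_⟩
      rw [norm_mul_exp_arg_mul_I, add_sub_cancel]
    · rintro ⟨ρ, θ, ⟨h1, h2⟩, rfl⟩
      have hρ : 0 < ρ := hr.trans_lt h1
      have : ‖c + (ρ : ℂ) * exp ((θ : ℂ) * I) - c‖ = ρ := by
        rw [add_sub_cancel_left, norm_mul, Complex.norm_exp_ofReal_mul_I, mul_one, Complex.norm_real,
          Real.norm_of_nonneg hρ.le]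
      rw [this]; exact ⟨h2, h1⟩
  rw [heq]
  exact (isPreconnected_Ioo.prod isPreconnected_univ).image _ (Continuous.continuousOn (by fun_prop))

/-- The frontier of the open annulus lies in the two circles. [folklore] -/
private theorem frontier_ball_diff_closedBall_subset (c : ℂ) (r R : ℝ) :
    frontier (ball c R \ closedBall c r) ⊆ sphere c r ∪ sphere c R := by
  intro z hz
  rw [(isOpen_ball.sdiff isClosed_closedBall).frontier_eq] at hz
  obtain ⟨hzc, hzU⟩ := hz
  have h1 : z ∈ closedBall c R := closure_ball_subset_closedBall (closure_mono sdiff_subset hzc)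
  have h2 : z ∉ ball c r := by
    have hcl : closure (ball c R \ closedBall c r) ⊆ (ball c r)ᶜ :=
      closure_minimal (fun w hw hw' => hw.2 (ball_subset_closedBall hw')) isOpen_ball.isClosed_compl
    exact hcl hzc
  rw [mem_closedBall] at h1
  rw [mem_ball, not_lt] at h2
  rcases h1.lt_or_eq with hlt | heq
  · left
    have hle : dist z c ≤ r := by
      by_contra h
      exact hzU ⟨mem_ball.2 hlt, fun h' => h (mem_closedBall.1 h')⟩
    exact mem_sphere.2 (le_antisymm hle h2)
  · right; exact mem_sphere.2 heq

/-- A point of the closed annulus lies in the open annulus or on one of the two circles. [folklore] -/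
private theorem mem_sphere_or_of_mem_closedBall_diff_ball {c z : ℂ} {r R : ℝ} (hz : z ∈ closedBall c R \ ball c r) :
    z ∈ ball c R \ closedBall c r ∨ z ∈ sphere c r ∨ z ∈ sphere c R := by
  simp only [Set.mem_sdiff, mem_closedBall, mem_ball, not_lt, mem_sphere, not_le] at hz ⊢
  obtain ⟨h1, h2⟩ := hz
  rcases h1.lt_or_eq with h1 | h1
  · rcases h2.lt_or_eq with h2 | h2
    · exact Or.inl ⟨h1, h2⟩
    · exact Or.inr (Or.inl h2.symm)
  · exact Or.inr (Or.inr h1)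

/-! ### §1 Two facts about the Poisson integral -/

variable {c : ℂ} {R : ℝ} {φ : ℂ → ℝ}

/-- **`|P[φ]| ≤ K` on the CLOSED disc** when `|φ| ≤ K` on the circle: inside this is the tree's
`abs_circleAverage_poissonKernel_mul_le` (positivity and unit mass of the Poisson kernel), on the circle it
is the hypothesis. [cite: Conway1978, Ch. X Prop. 2.4 (proof)] [folklore] -/
theorem abs_discPoisson_le {K : ℝ} (hφ : ContinuousOn φ (sphere c R)) (hK : ∀ z ∈ sphere c R, |φ z| ≤ K)
    {w : ℂ} (hw : w ∈ closedBall c R) : |discPoisson c R φ w| ≤ K := by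
  by_cases hwb : w ∈ ball c R
  · rw [discPoisson_eq_of_mem_ball hwb]
    exact abs_circleAverage_poissonKernel_mul_le hφ hK hwb
  · have hws : w ∈ sphere c R := by
      rw [mem_sphere]; rw [mem_closedBall] at hw; rw [mem_ball, not_lt] at hwb
      exact le_antisymm hw hwb
    rw [discPoisson_eq_of_mem_sphere hws]; exact hK w hws

/-- **At the centre the Poisson integral is the circle mean**: `P[φ](c) = ⨍_{|z-c|=R} φ` (the kernel is `1`
there). [folklore] -/
private theorem discPoisson_apply_center (hR : 0 < R) : discPoisson c R φ c = circleAverage φ c R := by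
  rw [discPoisson_eq_of_mem_ball (mem_ball_self hR)]
  apply circleAverage_congr_sphere
  intro z hz
  rw [abs_of_pos hR, mem_sphere, dist_eq_norm] at hz
  have hne : ‖z - c‖ ≠ 0 := by rw [hz]; exact hR.ne'
  simp only [poissonKernel_eq, sub_self, norm_zero, ne_eq, OfNat.ofNat_ne_zero, not_false_eq_true,
    zero_pow, sub_zero]
  rw [div_self (pow_ne_zero 2 hne), one_mul]

/-! ### §2 A Schwarz lemma for harmonic functions (from Harnack's inequality) -/

/-- **Harmonic Schwarz lemma.** If `u` is harmonic on the disc `B(c, R)`, `|u| ≤ K` there and `u(c) = 0`,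
then `|u(z)| ≤ 2K‖z − c‖/R` on the disc (Harnack's inequality for the nonnegative harmonic functions
`K ± u` on the discs `B̄(c, R')`, `R' ↑ R`; a direct consequence of Harnack's inequality IV.1.5, the tree's
`TuranNazarov.harnack`). [cite: FarkasKra1992, IV.1.5] [folklore] -/
theorem abs_le_of_harmonicOnNhd_ball_of_apply_center {u : ℂ → ℝ} {K : ℝ}
    (hu : HarmonicOnNhd u (ball c R)) (hK : ∀ z ∈ ball c R, |u z| ≤ K) (h0 : u c = 0)
    {z : ℂ} (hz : z ∈ ball c R) : |u z| ≤ 2 * K * ‖z - c‖ / R := by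
  have hR : 0 < R := lt_of_le_of_lt dist_nonneg (mem_ball.1 hz)
  have hK0 : 0 ≤ K := (abs_nonneg _).trans (hK c (mem_ball_self hR))
  set d := ‖z - c‖ with hd
  have hdR : d < R := by rwa [mem_ball, dist_eq_norm] at hz
  by_cases hd0 : d = 0
  · have : z = c := by rwa [hd, norm_eq_zero, sub_eq_zero] at hd0
    rw [this, h0, abs_zero, hd0]; positivity
  have hdpos : 0 < d := lt_of_le_of_ne (norm_nonneg _) (Ne.symm hd0)
  -- the bound on every closed disc `B̄(c, R')`, `d < R' < R`
  have hstep : ∀ R' ∈ Ioo d R, |u z| ≤ 2 * K * d / (R' + d) := by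
    intro R' hR'
    have hsub : closedBall c R' ⊆ ball c R := closedBall_subset_ball hR'.2
    have hzR' : z ∈ ball c R' := by rw [mem_ball, dist_eq_norm]; exact hR'.1
    have hsph : ∀ x ∈ sphere c R', |u x| ≤ K := fun x hx => hK x (hsub (sphere_subset_closedBall hx))
    have hplus : HarmonicOnNhd (fun x => K - u x) (closedBall c R') :=
      (harmonicOnNhd_const K).sub (hu.mono hsub)
    have hminus : HarmonicOnNhd (fun x => K + u x) (closedBall c R') :=
      (harmonicOnNhd_const K).add (hu.mono hsub)
    have h1 := (Literature.Analysis.Approximation.TuranNazarov.harnack hplus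
      (fun x hx => sub_nonneg.2 ((le_abs_self _).trans (hsph x hx))) hzR').1
    have h2 := (Literature.Analysis.Approximation.TuranNazarov.harnack hminus
      (fun x hx => by linarith [neg_abs_le (u x), hsph x hx]) hzR').1
    simp only [h0, sub_zero, add_zero] at h1 h2
    have hden : 0 < R' + d := by linarith [hR'.1]
    have hfrac : (R' - d) / (R' + d) * K = K - 2 * K * d / (R' + d) := by
      field_simp; ring
    rw [hfrac] at h1 h2
    rw [abs_le]; constructor <;> linarith
  -- let `R' ↑ R`
  have hlim : Tendsto (fun R' : ℝ => 2 * K * d / (R' + d)) (𝓝[<] R) (𝓝 (2 * K * d / (R + d))) := by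
    have : ContinuousAt (fun R' : ℝ => 2 * K * d / (R' + d)) R :=
      ContinuousAt.div continuousAt_const (continuousAt_id.add continuousAt_const) (by linarith)
    exact this.tendsto.mono_left nhdsWithin_le_nhds
  have hev : ∀ᶠ R' in 𝓝[<] R, |u z| ≤ 2 * K * d / (R' + d) := by
    filter_upwards [Ioo_mem_nhdsLT hdR] with R' hR' using hstep R' hR'
  have hbound : |u z| ≤ 2 * K * d / (R + d) := ge_of_tendsto hlim hev
  calc |u z| ≤ 2 * K * d / (R + d) := hbound
    _ ≤ 2 * K * d / R := by
        apply div_le_div_of_nonneg_left (by positivity) hR (by linarith)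

/-! ### §3 The maximum principle on a closed annulus -/

/-- **Two-sided maximum principle on a closed annulus**: a function continuous on `r ≤ ‖z − c‖ ≤ R`
(`0 < r < R`), harmonic inside, and bounded by `L` in absolute value on the two circles is bounded by `L`
on the closed annulus (the tree's lim-sup maximum principle `harmonic_le_of_frontier_of_cocompact` on the
bounded preconnected open annulus, applied to `v` and `−v`).
[cite: Conway1978, Ch. X §1 (Maximum Principle, second version)] [folklore] -/
theorem abs_le_of_harmonicOnNhd_annulus {v : ℂ → ℝ} {r L : ℝ} (hr : 0 < r) (hrR : r < R)
    (hv : HarmonicOnNhd v (ball c R \ closedBall c r)) (hvc : ContinuousOn v (closedBall c R \ ball c r))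
    (hL : ∀ z ∈ sphere c r ∪ sphere c R, |v z| ≤ L) :
    ∀ z ∈ closedBall c R \ ball c r, |v z| ≤ L := by
  set U : Set ℂ := ball c R \ closedBall c r with hUdef
  set A : Set ℂ := closedBall c R \ ball c r with hAdef
  have hUo : IsOpen U := isOpen_ball.sdiff isClosed_closedBall
  have hUc : IsPreconnected U := isPreconnected_ball_diff_closedBall c R hr.le
  have hUA : U ⊆ A := fun z hz => ⟨ball_subset_closedBall hz.1, fun h => hz.2 (ball_subset_closedBall h)⟩
  have hSA : sphere c r ∪ sphere c R ⊆ A := by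
    rintro z (hz | hz)
    · refine ⟨?_, fun h => ?_⟩
      · rw [mem_closedBall]; rw [mem_sphere] at hz; rw [hz]; exact hrR.le
      · rw [mem_ball] at h; rw [mem_sphere] at hz; exact (lt_irrefl r) (hz ▸ h)
    · refine ⟨sphere_subset_closedBall hz, fun h => ?_⟩
      rw [mem_ball] at h; rw [mem_sphere] at hz; rw [hz] at h; exact (lt_irrefl _) (h.trans hrR)
  -- boundary behaviour from continuity on the closed annulus
  have hbdry : ∀ (g : ℂ → ℝ), ContinuousOn g A → (∀ z ∈ sphere c r ∪ sphere c R, g z ≤ L) →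
      ∀ ζ ∈ frontier U, ∀ ε : ℝ, 0 < ε → ∀ᶠ z in 𝓝[U] ζ, g z ≤ L + ε := by
    intro g hg hgL ζ hζ ε hε
    have hζS := frontier_ball_diff_closedBall_subset c r R hζ
    have hζA : ζ ∈ A := hSA hζS
    have hcont : ContinuousWithinAt g A ζ := hg ζ hζA
    have hlt : ∀ᶠ z in 𝓝[A] ζ, g z < g ζ + ε :=
      hcont.eventually (Iio_mem_nhds (by linarith))
    refine (hlt.filter_mono (nhdsWithin_mono ζ hUA)).mono fun z hz => ?_
    linarith [hgL ζ hζS]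
  have hinf : ∀ (g : ℂ → ℝ) (M : ℝ), ∀ ε : ℝ, 0 < ε → ∀ᶠ z in cocompact ℂ ⊓ 𝓟 U, g z ≤ M + ε := by
    intro g M ε hε
    rw [Filter.eventually_inf_principal]
    filter_upwards [(isCompact_closedBall c R).compl_mem_cocompact] with z hz hzU
    exact absurd (ball_subset_closedBall hzU.1) hz
  have hup : ∀ z ∈ U, v z ≤ L :=
    harmonic_le_of_frontier_of_cocompact hUo hUc hv
      (hbdry v hvc fun z hz => (le_abs_self _).trans (hL z hz)) (hinf v L)
  have hdown : ∀ z ∈ U, -L ≤ v z := by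
    have h := harmonic_le_of_frontier_of_cocompact hUo hUc hv.neg (M := L)
      (hbdry (fun z => -v z) hvc.neg fun z hz => by linarith [neg_abs_le (v z), hL z hz]) (hinf _ L)
    intro z hz
    have := h z hz
    simp only [Pi.neg_apply] at this
    linarith
  intro z hz
  rcases mem_sphere_or_of_mem_closedBall_diff_ball hz with hzU | hzs | hzs
  · exact abs_le.2 ⟨hdown z hzU, hup z hzU⟩
  · exact hL z (Or.inl hzs)
  · exact hL z (Or.inr hzs)

/-! ### §4 The annulus Schwarz bound -/

/-- **Schwarz bound on a closed annulus.** Let `w` be continuous on `ρ ≤ ‖z − c‖ ≤ R` (`0 < ρ < R`) and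
harmonic inside, with `w = 0` on the inner circle, `|w| ≤ K` on the outer circle and ZERO MEAN on the outer
circle. Then `|w(z)| ≤ 4K‖z − c‖/R` on the closed annulus.  (With `h := P[w|_{‖z−c‖=R}]`: `h(c) = ⨍ w = 0`,
so `|h(z)| ≤ 2K‖z − c‖/R` by the harmonic Schwarz lemma; `w − h` is harmonic on the annulus, `0` on the
outer circle and of size `≤ 2Kρ/R` on the inner one, so `|w − h| ≤ 2Kρ/R ≤ 2K‖z − c‖/R` by the maximum
principle on the annulus.)  The zero-mean hypothesis cannot be dropped: `w = K log(‖z−c‖/ρ)/log(R/ρ)`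
satisfies the other three and equals `K/2` on `‖z − c‖ = √(ρR)`.  This is the content of Lin's Step 1
((*7)–(*12): the bound on `u_ρ − Re 1/z` across the annulus from its vanishing on the inner circle, its size
on the outer circle and zero flux), proved by comparison instead of Fourier series.
[cite: Lin2011ClassicalComplexAnalysisII, §7.3.3 (7.3.3.3) proof, Step 1 (*7)–(*12)] [folklore] -/
theorem abs_le_mul_norm_of_harmonicOnNhd_annulus {w : ℂ → ℝ} {ρ K : ℝ} (hρ : 0 < ρ) (hρR : ρ < R)
    (hw : HarmonicOnNhd w (ball c R \ closedBall c ρ)) (hwc : ContinuousOn w (closedBall c R \ ball c ρ))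
    (h0 : ∀ z ∈ sphere c ρ, w z = 0) (hK : ∀ z ∈ sphere c R, |w z| ≤ K)
    (havg : circleAverage w c R = 0) :
    ∀ z ∈ closedBall c R \ ball c ρ, |w z| ≤ 4 * K * ‖z - c‖ / R := by
  have hR : 0 < R := hρ.trans hρR
  have hK0 : 0 ≤ K := by
    have hpt : (c + R : ℂ) ∈ sphere c R := by
      rw [mem_sphere, dist_eq_norm, add_sub_cancel_left, Complex.norm_real, Real.norm_of_nonneg hR.le]
    exact (abs_nonneg _).trans (hK _ hpt)
  have hSA : sphere c R ⊆ closedBall c R \ ball c ρ := fun z hz =>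
    ⟨sphere_subset_closedBall hz, fun h => by
      rw [mem_ball] at h; rw [mem_sphere] at hz; rw [hz] at h; exact (lt_irrefl _) (h.trans hρR)⟩
  have hws : ContinuousOn w (sphere c R) := hwc.mono hSA
  -- the Poisson integral `h` of `w|_{‖z − c‖ = R}`
  set h : ℂ → ℝ := discPoisson c R w with hh
  have hh_harm : HarmonicOnNhd h (ball c R) := harmonicOnNhd_discPoisson hR hws
  have hh_cont : ContinuousOn h (closedBall c R) := continuousOn_discPoisson hR hws
  have hh_bdd : ∀ z ∈ closedBall c R, |h z| ≤ K := fun z hz => abs_discPoisson_le hws hK hz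
  have hh_c : h c = 0 := by rw [hh, discPoisson_apply_center hR, havg]
  have hh_sph : ∀ z ∈ sphere c R, h z = w z := fun z hz => discPoisson_eq_of_mem_sphere hz
  have hh_schwarz : ∀ z ∈ closedBall c R, |h z| ≤ 2 * K * ‖z - c‖ / R := by
    intro z hz
    by_cases hzb : z ∈ ball c R
    · exact abs_le_of_harmonicOnNhd_ball_of_apply_center hh_harm
        (fun z hz => hh_bdd z (ball_subset_closedBall hz)) hh_c hzb
    · have hzs : ‖z - c‖ = R := by
        rw [mem_closedBall, dist_eq_norm] at hz; rw [mem_ball, dist_eq_norm, not_lt] at hzb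
        exact le_antisymm hz hzb
      rw [hzs, mul_div_assoc, div_self hR.ne', mul_one]
      linarith [hh_bdd z hz]
  -- `w − h` on the annulus
  have hv_harm : HarmonicOnNhd (fun z => w z - h z) (ball c R \ closedBall c ρ) :=
    hw.sub (hh_harm.mono sdiff_subset)
  have hv_cont : ContinuousOn (fun z => w z - h z) (closedBall c R \ ball c ρ) :=
    hwc.sub (hh_cont.mono sdiff_subset)
  have hv_bdry : ∀ z ∈ sphere c ρ ∪ sphere c R, |w z - h z| ≤ 2 * K * ρ / R := by
    rintro z (hz | hz)
    · have hzρ : ‖z - c‖ = ρ := by rwa [mem_sphere, dist_eq_norm] at hz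
      have hzR : z ∈ closedBall c R := by rw [mem_closedBall, dist_eq_norm, hzρ]; exact hρR.le
      rw [h0 z hz, zero_sub, abs_neg, ← hzρ]
      exact hh_schwarz z hzR
    · rw [hh_sph z hz, sub_self, abs_zero]; positivity
  have hv := abs_le_of_harmonicOnNhd_annulus hρ hρR hv_harm hv_cont hv_bdry
  intro z hz
  have hρz : ρ ≤ ‖z - c‖ := by
    have h2 := hz.2; rw [mem_ball, not_lt, dist_eq_norm] at h2; exact h2
  have h1 := hh_schwarz z hz.1
  have h2 : |w z - h z| ≤ 2 * K * ‖z - c‖ / R := (hv z hz).trans (by gcongr)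
  calc |w z| = |h z + (w z - h z)| := by rw [add_sub_cancel]
    _ ≤ |h z| + |w z - h z| := abs_add_le _ _
    _ ≤ 2 * K * ‖z - c‖ / R + 2 * K * ‖z - c‖ / R := add_le_add h1 h2
    _ = 4 * K * ‖z - c‖ / R := by ring

end Literature.Analysis.Complex

end
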